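import Summits.QuantumFields.YangMills.Theorems.BalabanLadderNTMarkovMirrorDefectTypical
import HarnessLib

/-!
# Crux `UVSeamRec` (stmt-QuantumFields-20043), stub `stub_floorsEngine` (S-B) / crux `NT` clause (i):
# (RBLΔ-L²) along a unit map from singleton RESPONSE MOMENTS of centred cubes; the clause-(i) package {MF, RM₁}

Helper file (`--supports stmt-QuantumFields-20043`) of the seam stub-prover row `ym-20043-seam-s1`, sequel of
`…NTMarkovMirrorDefectTypical` (conditional Jensen, nesting monotonicity of typical one-point laws, the mean-square
defect bound `defect_response_sq_le`).  General compact `G`, any lattice representation `r`; nothing here is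
`SU(2)`-specific (the specialisation to `(SU(2), rF, a/uRec → c₀)` and the verbatim (RM) shape of the registered
`stub_responseMomentsOdd6` are the sequel `…UVSeamRecFloorsEngineOfResponseMoments`).

The singleton response-moment law at a unit `a'` (reference values `p q β`, constants `C₁ > 0`, `B`, `β₁`, `ℓ₁ > 0`):

  (RM₁) for `β ≥ β₁`, every torus `2L+1`, orientation `q`, site `x`, radius `R ≥ 1` with `R·a'β ≤ ℓ₁`, `4R+8 ≤ L`:
        `E_T[exp((R⁴/C₁)·|kerE_{x−(R+1), 2R+3}^{lift U}(plane_q x) − p q β|)] ≤ e^B`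

— the `n = 1`, `T = {0}` case of the joint law (RM) (hypothesis of p532738 `TemperedResponse.stubCeilings_of_responseMoments`;
no separation clause survives at `n = 1`).

* §1 `torusE_sq_kerE_plane_le_of_expMoment` — (RM₁) for the centred cube of radius `R+1` around a plaquette at depth
  `≥ R+3` of a cube `Q` bounds `E_T[(kerE_Q(plane) − p)²]` by `2e^B C₁²/R⁸` on every torus `2L+1 ≥ b + 4`;
* §2 `defect_response_sq_le_linear` — at spacing `s`, a typical law `E_T[(kerE_Q(plane_q x) − p_q)²] ≤ (C₁/depth⁴)²` on
  the `e₀`-thickened support at depth `≥ κ/s` gives `E_T[(defect − p')²] ≤ (C_Δ·s)²`, `C_Δ = 12·7⁴·Lip(v)·C₁·M⁴/κ⁴`;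
  `rblΔ_l2_eventually_of_typicalLaw` — along a unit map `a → 0⁺`: (RBLΔ-L²) `≤ η`, eventually, on every torus;
* §3 **`typicalLaw_of_responseMoments`** — (RM₁) at `a'`, a cube family `Q_β` of physical size `≤ Λ₅` in the unit `a`
  that is FEMTO IN THE UNIT `a'` (`b_β·a'β ≤ ℓ₁`) and carries the thickened support at physical depth `≥ κ`: eventually
  in `β`, on every torus `2Λ₅ ≤ aβ·L`, the typical law with constant `4⁴·C₁·(1 + e^B)`;
  **`rblΔ_l2_eventually_of_responseMoments`** = §3 ⊕ §2;
* the clause-(i) package {MF, RM₁} along a unit map is the sequel `…NTMarkovMirrorResponseMomentsPackage`.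

Located reading (owner's pen, no registry content): with this file the (S-B) residual of record {BL6, MF, clause (ii)}
(R87 (1)) may drop the `∀`-exterior law BL6 in favour of (RM₁) ⊂ (RM), which the v5(α) slot already owes for (S-A) —
modulo the femto-commensurability clause `b_β·a'β ≤ ℓ₁` between the floors' cube family and (RM)'s range.  Honest
status: kernel-checked implications on a CONDITIONAL chain; (RM) is an OPEN RG statement (E0′-K with background;
high-temperature-inhabited, p533459); MF and clause (ii) are crux `NT`'s open mathematics (barrier
`PerturbativeInvisibility`).  Refs: Georgii 2011, Def. 1.23 (iii) / Thm. 4.17; card E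
`Cruxes/NT/Ideas/markov-mirror-dirichlet-response.md`.
-/

set_option autoImplicit false

noncomputable section

open scoped SchwartzMap
open MeasureTheory Filter Topology
open Literature.MathematicalPhysics.QuantumFieldTheory Literature.MathematicalPhysics.QuantumLattice
open Literature.Probability.LatticeModels
open Summit.QuantumFields.YangMills.Cruxes.OSLegsFromFemtoAndGap.DlrCollarTransfer
open Summit.QuantumFields.YangMills.Cruxes.OSLegsFromFemtoAndGap.DlrCollarTransfer.StubLower (mem_cubeSites_iff)
open Summit.QuantumFields.YangMills.Cruxes.OSLegsAtWeakCouplingC.InheritedAmplitudeGates.StubInherit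
  (window_of_depth_pos)
open Summit.QuantumFields.YangMills.Cruxes.NT.Reference (continuous_kerE eventually_le_of_tendsto div_pow_depth_le)
open Summit.QuantumFields.YangMills.Cruxes.NT.BoundaryLaw
  (window_of_succ_le_depth two_mul_add_one_le_of_le_depth)
open Summit.QuantumFields.YangMills.Cruxes.UVSeamRec.UnitTransfer (exists_radius)

namespace Summit.QuantumFields.YangMills.Cruxes.NT.MarkovMirror

/-! ## §1 A centred-cube response moment bounds the typical response of the big cube -/

section Centred

variable (G : Type) [Group G] [TopologicalSpace G] [IsTopologicalGroup G] [CompactSpace G]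
  [MeasurableSpace G] [BorelSpace G] (r : LatticeRep G)

/-- **A centred-cube response moment bounds the typical response of the big cube.**  Let `Q = (c, b)` be a cube,
`x` a site at depth `≥ R + 3` in `Q` (`1 ≤ R`), `q` an orientation, `p` a reference value, `C₁ > 0`, and
`2L+1 ≥ b + 4`.  If the singleton response moment of the CENTRED cube `Q_x = (x − (R+1), 2R+3)` obeys
`E_T[exp((R⁴/C₁)|kerE_{Q_x}^{lift U}(plane_q x) − p|)] ≤ e^B`, then
`E_T[(kerE_Q^{lift U}(plane_q x) − p)²] ≤ 2e^B C₁²/R⁸` (`torusE_sq_kerE_le_of_nested` + `torusE_sq_le_of_expMoment`).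
[folklore] -/
theorem torusE_sq_kerE_plane_le_of_expMoment (β : ℝ) (c : Fin 4 → ℤ) (b L : ℕ) (hL : b + 4 ≤ 2 * L + 1)
    (q : Fin 4 × Fin 4) {x : Fin 4 → ℤ} {R : ℕ} (hR : 1 ≤ R) (hx : R + 3 ≤ depth c b x) (p : ℝ) {C₁ B : ℝ}
    (hC₁ : 0 < C₁)
    (h : torusE G r β L (fun V => Real.exp ((R : ℝ) ^ 4 / C₁ *
      |kerE G r β (fun k => x k - (R + 1)) (2 * R + 3) V (plane G r q x) - p|)) ≤ Real.exp B) :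
    torusE G r β L (fun V => (kerE G r β c b V (plane G r q x) - p) ^ 2) ≤
      2 * Real.exp B * C₁ ^ 2 / (R : ℝ) ^ 8 := by
  obtain ⟨CA, hCA⟩ := exists_abs_plane_le r
  -- the centred cube of radius `R + 1` sits at depth `≥ 1` inside `Q`
  have hwin : ∀ j, c j + 1 ≤ x j - (R + 1) ∧ (x j - (R + 1)) + ((2 * R + 3 : ℕ) : ℤ) + 1 ≤ c j + b := by
    intro j
    have h := window_of_succ_le_depth (n := R + 2) (by omega) j
    push_cast at h ⊢
    constructor <;> linarith [h.1, h.2]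
  have hS : ∀ e ∈ (originPlaquetteSupport q.1 q.2).image (fun e => (e.1 - -x, e.2)), ∀ j,
      x j - (R + 1) ≤ e.1 j ∧ e.1 j ≤ x j - (R + 1) + ((2 * R + 3 : ℕ) : ℤ) := by
    intro e he j
    have h01 := near_of_mem_supp_plane he j
    push_cast
    constructor <;> linarith [h01.1, h01.2]
  have hnest := torusE_sq_kerE_le_of_nested G r β hwin L hL (continuous_plane r q x) (hCA q x)
    (isCylinder_plane r q x) hS p
  refine hnest.trans ?_
  have hlam : (0 : ℝ) < (R : ℝ) ^ 4 / C₁ := by positivity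
  have hsq := torusE_sq_le_of_expMoment G r β L
    ((continuous_kerE G r β _ _ (continuous_plane r q x) (hCA q x)).sub continuous_const) hlam h
  refine hsq.trans (le_of_eq ?_)
  have hR0 : (R : ℝ) ≠ 0 := by exact_mod_cast (show R ≠ 0 by omega)
  field_simp

end Centred

/-! ## §2 The mean-square defect bound is `O(s²)`; eventual smallness along a unit map -/

section Linear

variable (G : Type) [Group G] [TopologicalSpace G] [IsTopologicalGroup G] [CompactSpace G]
  [MeasurableSpace G] [BorelSpace G] (r : LatticeRep G)

/-- **The mean-square defect response is `O(s²)` under a TYPICAL plane law on the cube.**  At spacing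
`0 < s ≤ M`: a cube `Q = (c, b)`; a test function `v` with `v z ≠ 0 → ‖z‖ ≤ M` (`M ≥ 1`) and increments bounded
through `Lv`; lattice support of `v(s·)` in `Q` at depth `≥ 2`, the `e₀`-thickened support in `Q` at depth `≥ κ/s`;
per-site MEAN-SQUARE law `E_T[(kerE_Q^{lift U}(plane_q x) − p_q)²] ≤ (C₁/depth(x)⁴)²` for electric `q` on the
thickened support, on the torus `2L+1`.  Then `E_T[(kerE_Q(Wᴿ) − kerE_Q(Ṽ) − p')²∘lift] ≤ ((12·7⁴·Lv·C₁·M⁴/κ⁴)·s)²`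
(`defect_response_sq_le` with the three factors of `defect_response_le_linear`). [folklore] -/
theorem defect_response_sq_le_linear (β : ℝ) (c : Fin 4 → ℤ) (b L : ℕ) {s M κ C₁ Lv : ℝ} (hs : 0 < s)
    (hsM : s ≤ M) (hM1 : 1 ≤ M) (hκ : 0 < κ) (hC₁ : 0 ≤ C₁) (hLv : 0 ≤ Lv) (v : 𝓢(EuclideanSpace ℝ (Fin 4), ℝ))
    (hvM : ∀ z, v z ≠ 0 → ‖z‖ ≤ M)
    (hvL : ∀ z z' : EuclideanSpace ℝ (Fin 4), |v z - v z'| ≤ Lv * ‖z - z'‖)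
    (hsupp : ∀ x : Fin 4 → ℤ, v (s • siteToE x) ≠ 0 → x ∈ cubeSites c b ∧ 2 ≤ depth c b x)
    (hthick : ∀ x : Fin 4 → ℤ, (v (s • siteToE x) ≠ 0 ∨ v (s • siteToE (x + Pi.single 0 1)) ≠ 0) →
      x ∈ cubeSites c b ∧ κ / s ≤ (depth c b x : ℝ))
    (pq : {q : Fin 4 × Fin 4 // q.1 < q.2} → ℝ)
    (hBL2 : ∀ q : {q : Fin 4 × Fin 4 // q.1 < q.2}, q.1.1 = 0 → ∀ x ∈ cubeSites c b,
      (v (s • siteToE x) ≠ 0 ∨ v (s • siteToE (x + Pi.single 0 1)) ≠ 0) →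
        torusE G r β L (fun V => (kerE G r β c b V (plane G r q.1 x) - pq q) ^ 2) ≤
          (C₁ / (depth c b x : ℝ) ^ 4) ^ 2) :
    torusE G r β L (fun V => (kerE G r β c b V (fun V => ∑ x ∈ cubeSites c b, v (s • siteToE x) *
          ∑ q : {q : Fin 4 × Fin 4 // q.1 < q.2}, plane G r q.1 (if q.1.1 = 0 then x - Pi.single 0 1 else x) V) -
        kerE G r β c b V (fun V => ∑ y ∈ cubeSites c b, v (s • siteToE y) * dens G r y V) -
        ∑ x ∈ cubeSites c b, (v (s • siteToE (x + Pi.single 0 1)) - v (s • siteToE x)) *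
          ∑ q : {q : Fin 4 × Fin 4 // q.1 < q.2}, (if q.1.1 = 0 then pq q else 0)) ^ 2) ≤
      ((12 * 7 ^ 4 * Lv * C₁ * M ^ 4 / κ ^ 4) * s) ^ 2 := by
  classical
  -- the three factors
  have hK : ∀ x : Fin 4 → ℤ, |v (s • siteToE (x + Pi.single 0 1)) - v (s • siteToE x)| ≤ Lv * (2 * s) :=
    fun x => (hvL _ _).trans (mul_le_mul_of_nonneg_left (norm_smul_siteToE_add_single_sub_le hs.le x) hLv)
  have hh : ∀ q : {q : Fin 4 × Fin 4 // q.1 < q.2}, q.1.1 = 0 → ∀ x ∈ cubeSites c b,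
      (v (s • siteToE x) ≠ 0 ∨ v (s • siteToE (x + Pi.single 0 1)) ≠ 0) →
        torusE G r β L (fun V => (kerE G r β c b V (plane G r q.1 x) - pq q) ^ 2) ≤ (C₁ * (s / κ) ^ 4) ^ 2 :=
    fun q hq x hx hv => (hBL2 q hq x hx hv).trans (pow_le_pow_left₀ (by positivity)
      (div_pow_depth_le hC₁ hκ hs (hthick x hv).2) 2)
  set N : ℕ := ⌈M / s⌉₊ + 1 with hN
  have hcount : ((cubeSites c b).filter fun x =>
      v (s • siteToE x) ≠ 0 ∨ v (s • siteToE (x + Pi.single 0 1)) ≠ 0).card ≤ (2 * N + 1) ^ 4 := by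
    rw [← card_box 4 N]
    refine Finset.card_le_card fun x hx => ?_
    exact mem_box_of_thickSupport hs hvM x (Finset.mem_filter.1 hx).2
  have hmain := defect_response_sq_le G r β c b L s v hsupp pq (h := C₁ * (s / κ) ^ 4) (K := Lv * (2 * s))
    (by positivity) hh hK ((2 * N + 1) ^ 4) hcount
  refine hmain.trans (pow_le_pow_left₀ (by positivity) ?_ 2)
  -- arithmetic: `(2N+1)⁴ · 2Lv s · 6 C₁ (s/κ)⁴ ≤ 12·7⁴ Lv C₁ M⁴/κ⁴ · s` using `2N + 1 ≤ 7M/s`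
  have hNle : ((2 * N + 1 : ℕ) : ℝ) ≤ 7 * M / s := by
    have hceil : (⌈M / s⌉₊ : ℝ) < M / s + 1 := Nat.ceil_lt_add_one (by positivity)
    have h1 : ((2 * N + 1 : ℕ) : ℝ) = 2 * (⌈M / s⌉₊ : ℝ) + 3 := by rw [hN]; push_cast; ring
    rw [h1, le_div_iff₀ hs]
    have hMs : M / s * s = M := div_mul_cancel₀ M hs.ne'
    nlinarith [hsM, hceil, hMs, hs]
  have hpow : (((2 * N + 1) ^ 4 : ℕ) : ℝ) ≤ (7 * M / s) ^ 4 := by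
    push_cast
    have h0 : (0 : ℝ) ≤ ((2 * N + 1 : ℕ) : ℝ) := by positivity
    have := pow_le_pow_left₀ h0 hNle 4
    push_cast at this
    exact this
  have hrhs : (7 * M / s) ^ 4 * (Lv * (2 * s) * (6 * (C₁ * (s / κ) ^ 4))) =
      (12 * 7 ^ 4 * Lv * C₁ * M ^ 4 / κ ^ 4) * s := by
    field_simp
    ring
  calc (((2 * N + 1) ^ 4 : ℕ) : ℝ) * (Lv * (2 * s) * (6 * (C₁ * (s / κ) ^ 4)))
      ≤ (7 * M / s) ^ 4 * (Lv * (2 * s) * (6 * (C₁ * (s / κ) ^ 4))) :=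
        mul_le_mul_of_nonneg_right hpow (by positivity)
    _ = (12 * 7 ^ 4 * Lv * C₁ * M ^ 4 / κ ^ 4) * s := hrhs

/-- **(RBLΔ-L²) from a typical plane law on the cube family, eventually.**  Along a unit map `a → 0⁺`, for ONE
compactly supported test function `v`, cubes `Q_β` carrying the lattice support of `v(aβ·)` at depth `≥ 2` and its
`e₀`-thickening at depth `≥ κ/aβ`, and the per-site MEAN-SQUARE law
`E_T[(kerE_{Q_β}^{lift U}(plane_q x) − p_q β)²] ≤ (C₁/depth⁴)²` (electric `q`, thickened support) on the tori
`Λ₅ ≤ aβ·L`: for every `η > 0`, eventually in `β`, on every such torus,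
`E_T[(kerE_{Q_β}(Wᴿ) − kerE_{Q_β}(Ṽ) − p' β)²∘lift] ≤ η` — the typical twin of `defect_response_eventually_le`.
[folklore] -/
theorem rblΔ_l2_eventually_of_typicalLaw (a : ℝ → ℝ) (ha₀ : ∀ β, 0 < a β) (ha : Tendsto a atTop (𝓝 0))
    (v : 𝓢(EuclideanSpace ℝ (Fin 4), ℝ)) (hvK : HasCompactSupport (v : EuclideanSpace ℝ (Fin 4) → ℝ))
    {κ C₁ : ℝ} (hκ : 0 < κ) (hC₁ : 0 ≤ C₁) {β₅ Λ₅ : ℝ} (c : ℝ → (Fin 4 → ℤ)) (b : ℝ → ℕ)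
    (p6 : ℝ → {q : Fin 4 × Fin 4 // q.1 < q.2} → ℝ)
    (hsupp : ∀ β, β₅ ≤ β → ∀ x : Fin 4 → ℤ, v (a β • siteToE x) ≠ 0 →
      x ∈ cubeSites (c β) (b β) ∧ 2 ≤ depth (c β) (b β) x)
    (hthick : ∀ β, β₅ ≤ β → ∀ x : Fin 4 → ℤ,
      (v (a β • siteToE x) ≠ 0 ∨ v (a β • siteToE (x + Pi.single 0 1)) ≠ 0) →
        x ∈ cubeSites (c β) (b β) ∧ κ / a β ≤ (depth (c β) (b β) x : ℝ))
    (hBL2 : ∀ β, β₅ ≤ β → ∀ L : ℕ, Λ₅ ≤ a β * L →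
      ∀ q : {q : Fin 4 × Fin 4 // q.1 < q.2}, q.1.1 = 0 → ∀ x ∈ cubeSites (c β) (b β),
        (v (a β • siteToE x) ≠ 0 ∨ v (a β • siteToE (x + Pi.single 0 1)) ≠ 0) →
          torusE G r β L (fun V => (kerE G r β (c β) (b β) V (plane G r q.1 x) - p6 β q) ^ 2) ≤
            (C₁ / (depth (c β) (b β) x : ℝ) ^ 4) ^ 2)
    {η : ℝ} (hη : 0 < η) :
    ∃ β₆ : ℝ, ∀ β, β₆ ≤ β → ∀ L : ℕ, Λ₅ ≤ a β * L →
      torusE G r β L (fun V => (kerE G r β (c β) (b β) V (fun V => ∑ x ∈ cubeSites (c β) (b β),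
            v (a β • siteToE x) * ∑ q : {q : Fin 4 × Fin 4 // q.1 < q.2},
              plane G r q.1 (if q.1.1 = 0 then x - Pi.single 0 1 else x) V) -
          kerE G r β (c β) (b β) V (fun V => ∑ y ∈ cubeSites (c β) (b β), v (a β • siteToE y) * dens G r y V) -
          ∑ x ∈ cubeSites (c β) (b β), (v (a β • siteToE (x + Pi.single 0 1)) - v (a β • siteToE x)) *
            ∑ q : {q : Fin 4 × Fin 4 // q.1 < q.2}, (if q.1.1 = 0 then p6 β q else 0)) ^ 2) ≤ η := by
  obtain ⟨M, hM1, hvM⟩ := exists_radius hvK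
  obtain ⟨Lv, hLv, hvL⟩ := exists_lipschitz_bound v hvK
  set CΔ : ℝ := 12 * 7 ^ 4 * Lv * C₁ * M ^ 4 / κ ^ 4 with hCΔ
  have hCΔ0 : 0 ≤ CΔ := by positivity
  have hm0 : 0 < min 1 η := lt_min one_pos hη
  have hδ : 0 < min M (min 1 η / (CΔ + 1)) := lt_min (by linarith) (by positivity)
  obtain ⟨βa, hβa⟩ := eventually_le_of_tendsto ha hδ
  refine ⟨max β₅ βa, fun β hβ L hL => ?_⟩
  have hβ₅ : β₅ ≤ β := le_trans (le_max_left _ _) hβ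
  have hβa' : βa ≤ β := le_trans (le_max_right _ _) hβ
  have hα : 0 < a β := ha₀ β
  have hsm := hβa β hβa'
  have hsM : a β ≤ M := hsm.trans (min_le_left _ _)
  have hsη : a β ≤ min 1 η / (CΔ + 1) := hsm.trans (min_le_right _ _)
  have hlin := defect_response_sq_le_linear G r β (c β) (b β) L hα hsM hM1 hκ hC₁ hLv v hvM hvL (hsupp β hβ₅)
    (hthick β hβ₅) (p6 β) (hBL2 β hβ₅ L hL)
  refine hlin.trans ?_
  rw [← hCΔ]
  -- `CΔ·aβ ≤ min 1 η`, hence `(CΔ·aβ)² ≤ (min 1 η)² ≤ η`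
  have h1 : CΔ * a β ≤ min 1 η := by
    calc CΔ * a β ≤ CΔ * (min 1 η / (CΔ + 1)) := mul_le_mul_of_nonneg_left hsη hCΔ0
      _ ≤ min 1 η := by
          rw [mul_div_assoc']
          exact (div_le_iff₀ (by positivity)).2 (by nlinarith [hm0.le])
  have h2 : (CΔ * a β) ^ 2 ≤ (min 1 η) ^ 2 := pow_le_pow_left₀ (by positivity) h1 2
  have h3 : (min 1 η) ^ 2 ≤ η := by
    have ha1 : min 1 η ≤ 1 := min_le_left _ _
    have haη : min 1 η ≤ η := min_le_right _ _
    nlinarith [hm0.le]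
  exact h2.trans h3

end Linear

/-! ## §3 The typical plane law on the cube family from singleton response moments -/

section ResponseMoments

variable (G : Type) [Group G] [TopologicalSpace G] [IsTopologicalGroup G] [CompactSpace G]
  [MeasurableSpace G] [BorelSpace G] (r : LatticeRep G)

/-- **Typical plane law on the cube family from (RM₁).**  A unit map `a > 0` with `a → 0`; (RM₁) at a unit `a'`
(reference values `p`, `C₁ > 0`, `B`, `β₁`, `ℓ₁ > 0`); per coupling `β ≥ β₅` a cube `Q_β = (c β, b β)` at times `≥ 1`
of physical size `(|c β j| + b β + 3)·aβ ≤ Λ₅`, FEMTO IN THE UNIT `a'` (`b β · a'β ≤ ℓ₁`), carrying the `e₀`-thickened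
lattice support of `v(aβ·)` at depth `≥ κ/aβ`.  Then eventually in `β`, on every torus `2Λ₅ ≤ aβ·L`, for every
orientation `q` and every site `x` of the thickened support:
`E_T[(kerE_{Q_β}^{lift U}(plane_q x) − p q β)²] ≤ (4⁴·C₁·(1 + e^B)/depth(x)⁴)²`.
(At depth `d ≥ 4` take `R = d − 3 ≥ d/4`: the centred cube of radius `R + 1` fits, `R·a'β ≤ b_β·a'β ≤ ℓ₁`,
`4R + 8 ≤ 2b_β − 2 ≤ L`; then §1 and `2e^B ≤ (1 + e^B)²`.) [folklore] -/
theorem typicalLaw_of_responseMoments (a a' : ℝ → ℝ) (ha₀ : ∀ β, 0 < a β) (ha : Tendsto a atTop (𝓝 0))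
    (v : 𝓢(EuclideanSpace ℝ (Fin 4), ℝ)) {κ C₁ B β₁ ℓ₁ β₅ Λ₅ : ℝ} (hκ : 0 < κ) (hC₁ : 0 < C₁) (hℓ₁ : 0 < ℓ₁)
    (p : Fin 4 × Fin 4 → ℝ → ℝ) (c : ℝ → (Fin 4 → ℤ)) (b : ℝ → ℕ)
    (hgeom : ∀ β, β₅ ≤ β → 1 ≤ c β 0 ∧ ∀ j : Fin 4, (|((c β j : ℤ) : ℝ)| + (b β : ℝ) + 3) * a β ≤ Λ₅)
    (hfemto : ∀ β, β₅ ≤ β → (b β : ℝ) * a' β ≤ ℓ₁)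
    (hthick : ∀ β, β₅ ≤ β → ∀ x : Fin 4 → ℤ,
      (v (a β • siteToE x) ≠ 0 ∨ v (a β • siteToE (x + Pi.single 0 1)) ≠ 0) →
        x ∈ cubeSites (c β) (b β) ∧ κ / a β ≤ (depth (c β) (b β) x : ℝ))
    (hRM : ∀ β : ℝ, β₁ ≤ β → ∀ (L : ℕ) (q : Fin 4 × Fin 4) (x : Fin 4 → ℤ) (R : ℕ), q.1 < q.2 → 1 ≤ R →
      (R : ℝ) * a' β ≤ ℓ₁ → 4 * R + 8 ≤ L →
      torusE G r β L (fun U => Real.exp ((R : ℝ) ^ 4 / C₁ *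
        |kerE G r β (fun k => x k - (R + 1)) (2 * R + 3) U (plane G r q x) - p q β|)) ≤ Real.exp B) :
    ∃ β₆ : ℝ, ∀ β, β₆ ≤ β → ∀ L : ℕ, 2 * Λ₅ ≤ a β * L →
      ∀ (q : {q : Fin 4 × Fin 4 // q.1 < q.2}) (x : Fin 4 → ℤ), x ∈ cubeSites (c β) (b β) →
        (v (a β • siteToE x) ≠ 0 ∨ v (a β • siteToE (x + Pi.single 0 1)) ≠ 0) →
          torusE G r β L (fun V => (kerE G r β (c β) (b β) V (plane G r q.1 x) - p q.1 β) ^ 2) ≤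
            (4 ^ 4 * C₁ * (1 + Real.exp B) / (depth (c β) (b β) x : ℝ) ^ 4) ^ 2 := by
  obtain ⟨βκ, hβκ⟩ := eventually_le_of_tendsto ha (show 0 < κ / 4 by positivity)
  refine ⟨max (max β₅ β₁) βκ, fun β hβ L hL q x _hx hxv => ?_⟩
  have hβ₅ : β₅ ≤ β := le_trans (le_trans (le_max_left _ _) (le_max_left _ _)) hβ
  have hβ₁ : β₁ ≤ β := le_trans (le_trans (le_max_right _ _) (le_max_left _ _)) hβ
  have hβκ' : βκ ≤ β := le_trans (le_max_right _ _) hβ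
  have hα : 0 < a β := ha₀ β
  obtain ⟨hc0, hsize⟩ := hgeom β hβ₅
  obtain ⟨hxc, hκd⟩ := hthick β hβ₅ x hxv
  -- depth `d ≥ 4`
  set d : ℕ := depth (c β) (b β) x with hd
  have h4d : (4 : ℝ) ≤ d := by
    have h1 : a β ≤ κ / 4 := hβκ β hβκ'
    have h2 : (4 : ℝ) ≤ κ / a β := by
      rw [le_div_iff₀ hα]
      calc 4 * a β ≤ 4 * (κ / 4) := by linarith
        _ = κ := by ring
    exact h2.trans hκd
  have h4d' : 4 ≤ d := by exact_mod_cast h4d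
  -- the radius `R = d − 3`
  obtain ⟨R, hRd⟩ : ∃ R : ℕ, d = R + 3 := ⟨d - 3, by omega⟩
  have hR1 : 1 ≤ R := by omega
  have hR3 : R + 3 ≤ depth (c β) (b β) x := by rw [← hd, hRd]
  -- `2d − 1 ≤ b`, torus sizes
  have h2d : 2 * (d - 1) + 1 ≤ b β := two_mul_add_one_le_of_le_depth (R := d - 1) (by rw [← hd]; omega)
  have hLb : 2 * b β + 6 ≤ L := by
    have h0 : 0 ≤ |((c β 0 : ℤ) : ℝ)| := abs_nonneg _
    have h1 : ((b β : ℝ) + 3) * a β ≤ Λ₅ := by nlinarith [hsize 0, hα]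
    have h2 : (2 * ((b β : ℝ) + 3)) * a β ≤ a β * L := by nlinarith
    have h3 : 2 * ((b β : ℝ) + 3) ≤ L := le_of_mul_le_mul_right (by nlinarith [h2]) hα
    have h4 : ((2 * b β + 6 : ℕ) : ℝ) ≤ (L : ℝ) := by push_cast; linarith
    exact_mod_cast h4
  have hL4 : b β + 4 ≤ 2 * L + 1 := by omega
  have h4R : 4 * R + 8 ≤ L := by omega
  -- femto in the unit `a'`
  have hRb : (R : ℝ) ≤ b β := by exact_mod_cast (show R ≤ b β by omega)
  have hRa' : (R : ℝ) * a' β ≤ ℓ₁ := by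
    rcases le_or_gt 0 (a' β) with ha' | ha'
    · exact (mul_le_mul_of_nonneg_right hRb ha').trans (hfemto β hβ₅)
    · have : (R : ℝ) * a' β ≤ 0 := mul_nonpos_of_nonneg_of_nonpos (Nat.cast_nonneg _) ha'.le
      linarith
  -- the centred response moment, then §1
  have hm := hRM β hβ₁ L q.1 x R q.2 hR1 hRa' h4R
  have key := torusE_sq_kerE_plane_le_of_expMoment G r β (c β) (b β) L hL4 q.1 hR1 hR3 (p q.1 β) hC₁ hm
  refine key.trans ?_
  -- `2e^B C₁²/R⁸ ≤ (4⁴ C₁ (1 + e^B)/d⁴)²` from `d ≤ 4R` and `2e^B ≤ (1 + e^B)²`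
  have hR0 : (0 : ℝ) < R := by exact_mod_cast hR1
  have hd0 : (0 : ℝ) < d := by linarith
  have hdR : (d : ℝ) ≤ 4 * R := by
    have : (d : ℝ) = R + 3 := by rw [hRd]; push_cast; ring
    rw [this]; linarith
  have hpow : (d : ℝ) ^ 8 ≤ 4 ^ 8 * (R : ℝ) ^ 8 := by
    rw [← mul_pow]; exact pow_le_pow_left₀ hd0.le hdR 8
  have heB : 2 * Real.exp B ≤ (1 + Real.exp B) ^ 2 := by nlinarith [Real.exp_pos B, sq_nonneg (Real.exp B - 1)]
  rw [div_pow, div_le_div_iff₀ (by positivity) (by positivity)]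
  calc 2 * Real.exp B * C₁ ^ 2 * ((d : ℝ) ^ 4) ^ 2 = 2 * Real.exp B * C₁ ^ 2 * (d : ℝ) ^ 8 := by ring
    _ ≤ (1 + Real.exp B) ^ 2 * C₁ ^ 2 * (4 ^ 8 * (R : ℝ) ^ 8) := by
        gcongr
    _ = (4 ^ 4 * C₁ * (1 + Real.exp B)) ^ 2 * (R : ℝ) ^ 8 := by ring

/-- **(RBLΔ-L²) from singleton response moments, eventually.**  Under the hypotheses of
`typicalLaw_of_responseMoments` plus the lattice support of `v(aβ·)` in `Q_β` at depth `≥ 2` and compact support of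
`v`: for every `η > 0`, eventually in `β`, on every torus `2Λ₅ ≤ aβ·L`, the mean-square chirality-defect bound
`E_T[(kerE_{Q_β}(Wᴿ) − kerE_{Q_β}(Ṽ) − p' β)²∘lift] ≤ η` holds with the reference value
`p' β = ∑_x [v(aβ·(x+e₀)) − v(aβ·x)] · ∑_{q electric} p q β` (`typicalLaw_of_responseMoments` ⊕
`rblΔ_l2_eventually_of_typicalLaw`). [folklore] -/
theorem rblΔ_l2_eventually_of_responseMoments (a a' : ℝ → ℝ) (ha₀ : ∀ β, 0 < a β) (ha : Tendsto a atTop (𝓝 0))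
    (v : 𝓢(EuclideanSpace ℝ (Fin 4), ℝ)) (hvK : HasCompactSupport (v : EuclideanSpace ℝ (Fin 4) → ℝ))
    {κ C₁ B β₁ ℓ₁ β₅ Λ₅ : ℝ} (hκ : 0 < κ) (hC₁ : 0 < C₁) (hℓ₁ : 0 < ℓ₁)
    (p : Fin 4 × Fin 4 → ℝ → ℝ) (c : ℝ → (Fin 4 → ℤ)) (b : ℝ → ℕ)
    (hgeom : ∀ β, β₅ ≤ β → 1 ≤ c β 0 ∧ ∀ j : Fin 4, (|((c β j : ℤ) : ℝ)| + (b β : ℝ) + 3) * a β ≤ Λ₅)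
    (hfemto : ∀ β, β₅ ≤ β → (b β : ℝ) * a' β ≤ ℓ₁)
    (hsupp : ∀ β, β₅ ≤ β → ∀ x : Fin 4 → ℤ, v (a β • siteToE x) ≠ 0 →
      x ∈ cubeSites (c β) (b β) ∧ 2 ≤ depth (c β) (b β) x)
    (hthick : ∀ β, β₅ ≤ β → ∀ x : Fin 4 → ℤ,
      (v (a β • siteToE x) ≠ 0 ∨ v (a β • siteToE (x + Pi.single 0 1)) ≠ 0) →
        x ∈ cubeSites (c β) (b β) ∧ κ / a β ≤ (depth (c β) (b β) x : ℝ))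
    (hRM : ∀ β : ℝ, β₁ ≤ β → ∀ (L : ℕ) (q : Fin 4 × Fin 4) (x : Fin 4 → ℤ) (R : ℕ), q.1 < q.2 → 1 ≤ R →
      (R : ℝ) * a' β ≤ ℓ₁ → 4 * R + 8 ≤ L →
      torusE G r β L (fun U => Real.exp ((R : ℝ) ^ 4 / C₁ *
        |kerE G r β (fun k => x k - (R + 1)) (2 * R + 3) U (plane G r q x) - p q β|)) ≤ Real.exp B)
    {η : ℝ} (hη : 0 < η) :
    ∃ β₇ : ℝ, ∀ β, β₇ ≤ β → ∀ L : ℕ, 2 * Λ₅ ≤ a β * L →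
      torusE G r β L (fun V => (kerE G r β (c β) (b β) V (fun V => ∑ x ∈ cubeSites (c β) (b β),
            v (a β • siteToE x) * ∑ q : {q : Fin 4 × Fin 4 // q.1 < q.2},
              plane G r q.1 (if q.1.1 = 0 then x - Pi.single 0 1 else x) V) -
          kerE G r β (c β) (b β) V (fun V => ∑ y ∈ cubeSites (c β) (b β), v (a β • siteToE y) * dens G r y V) -
          ∑ x ∈ cubeSites (c β) (b β), (v (a β • siteToE (x + Pi.single 0 1)) - v (a β • siteToE x)) *
            ∑ q : {q : Fin 4 × Fin 4 // q.1 < q.2}, (if q.1.1 = 0 then p q.1 β else 0)) ^ 2) ≤ η := by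
  obtain ⟨β₆, hlaw⟩ := typicalLaw_of_responseMoments G r a a' ha₀ ha v hκ hC₁ hℓ₁ p c b hgeom hfemto hthick hRM
  have hC' : 0 ≤ 4 ^ 4 * C₁ * (1 + Real.exp B) := by positivity
  obtain ⟨β₇, h⟩ := rblΔ_l2_eventually_of_typicalLaw G r a ha₀ ha v hvK hκ hC' (β₅ := max β₅ β₆) (Λ₅ := 2 * Λ₅)
    c b (fun β q => p q.1 β)
    (fun β hβ => hsupp β (le_trans (le_max_left _ _) hβ))
    (fun β hβ => hthick β (le_trans (le_max_left _ _) hβ))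
    (fun β hβ L hL q _ x hx hxv => hlaw β (le_trans (le_max_right _ _) hβ) L hL q x hx hxv) hη
  exact ⟨β₇, h⟩

end ResponseMoments

end Summit.QuantumFields.YangMills.Cruxes.NT.MarkovMirror

end
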